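import Summits.BirchSwinnertonDyer.BirchSwinnertonDyer.Theorems.PrintCf2SplitBadTwoLineOfScalarCharacter
import Summits.BirchSwinnertonDyer.BirchSwinnertonDyer.Theorems.PrintCf2SplitBadTwoLocalControlKernelDyadicTable
import Summits.BirchSwinnertonDyer.BirchSwinnertonDyer.Theorems.PrintCf2SplitBadTwoRestrictedSelmerCMSideConditions
import Summits.BirchSwinnertonDyer.BirchSwinnertonDyer.Theorems.PrintCf2SplitBadTwoCMPrimaryPinningSwap
import HarnessLib

/-!
# Crux `PrintCf2.SplitBadTwoRankOneOfFacts` (stmt-BirchSwinnertonDyer-20368), road α v10.3 — the class-field-theoretic input (C3), part 3: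
# **(C3) `ker κ' = ψ_{W*}⁻¹(±1)` ON EVERY S3c FRAME, (C3-loc) VERBATIM, AND THE RESIDUAL (R-DYADIC) OF THE S3c ASSEMBLY DISCHARGED**

Cell `bsd-print-cf2`, width seat `bsd-line-cf2-p1-w6` g3 (prover-bsd-line-cf2-p1-w6-g3-0). `--supports stmt-BirchSwinnertonDyer-20368`
(helper, Theses-free). HONEST FRAMING: nothing here closes the crux or a registered stub; BSD is not proved by any of this; no summit
statement is proved by this seat. No definition, no named fact, no `sorry`.

WHAT. On the S3c frame of the registered stub `stub_restrictedControl_two` (member `C • W = cm7^{(d)}`, `d ≠ 0`; `K` imaginary quadratic,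
`2 = v v̄` split; `π ∈ End_K(E_K)`, `π² = π − 2`; `r² = r − 2`; `W* = ↥((W.baseChange K).endEigenPrimaryTorsion 2 π r)` PINNED at `v` — the
clause «`GreenbergSelmer.inertia v` acts on `W*` pointwise as `±1`»; `κ'` ANY `ℤ₂`-extension of `K` unramified outside `v̄`):
* **`mem_kerSubgroup_iff_smul_of_frame`** — (C3) of -w2 g9's memo B15 §1: for EVERY `σ ∈ Γ_K`,
  **`σ ∈ ker κ'` iff `σ` acts on `W*` as `+1` or as `−1`** (`ker κ' = ψ_{W*}⁻¹(±1)`; `K*_∞ = K(W*)^{⟨−1⟩}`).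
  Part 2's abstract `mem_kerSubgroup_iff_smul_of_scalarAction_two` with: integer scalars / full levels (`endEigenPrimaryTorsion_two_structure`,
  -w2 g7), `2`-primary + open stabilisers (`exists_pow_smul_endEigenPrimaryTorsion_eq_zero`, `isOpen_stabilizer_endEigenPrimaryTorsion`, -w7),
  inertia at the places `w ∣ 2`, `w ≠ v̄` — i.e. at `w = v` (`eq_or_eq_of_two_mem`) — pointwise `±1` (THE PINNING CLAUSE), and an element acting
  as neither (inertia at `v̄` does NOT act pointwise as `±1` on `W*`: `endEigenPrimaryTorsion_two_pinningClause_swap`, -w4 g7 p654457).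
* **`kerC3_loc_of_frame`** — -w2 g9's (C3-loc) «`∀ σ ∈ decomp v̄, σ ∈ κ'.kerSubgroup ↔ (acts as +1) ∨ (acts as −1)`» VERBATIM.
* **`dyadicResidual_holds`** — the LEAD's residual **(R-DYADIC)** of the S3c assembly (`restrictedControl_two_of_residuals_noC1`, p667159,
  hypothesis `hDy`) VERBATIM: `∃ ev : ℤ → ℤ → ℤ, ∀ d …, v₂ #LK_{v̄} = ev (d % 2) ((d / (2 − d % 2)) % 8)` — from -w2 g9's
  `exists_ev_padicValNat_natCard_localKer_vbar_of_kerC3` (file 13, (R-DYADIC) ⟸ (C3-loc)) and `kerC3_loc_of_frame`. The LEAD feeds it by name.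
presearch: de Shalit 1987 II.1.9/II.4.17, Rubin LNM 1716 §3 Cor. 3.17, Agboola 2007 §3 Prop. 3.2 — held; parts 1–2 (`…LineUniqueness`,
`…LineOfScalarCharacter`) carry the CFT; no fact filed. beyond-print theorem: no.

References: [deShalit1987] II §1.9, §4.17; [Rubin1999] §3 Lemma 3.6 (ii), Cor. 3.17; [Agboola2007] §1, §3 Prop. 3.2; [Washington1997] §13.1.
-/

noncomputable section

open scoped Classical

set_option linter.dupNamespace false
set_option autoImplicit false

namespace Summit.BirchSwinnertonDyer.BirchSwinnertonDyer.Theorems.PrintCf2.RestrictedSelmerPair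

open NumberField IsDedekindDomain Field WeierstrassCurve
open Literature.NumberTheory.EllipticCurves Literature.NumberTheory.EllipticCurves.GreenbergSelmer
open Literature.NumberTheory.GaloisRepresentations
open Summit.BirchSwinnertonDyer.BirchSwinnertonDyer.Theorems.PrintCf2.AdditiveAtSeven
open Summit.BirchSwinnertonDyer.BirchSwinnertonDyer.Theorems.PrintCf2.CMPrimes
open Summit.BirchSwinnertonDyer.BirchSwinnertonDyer.Theorems.PrintCf2.LineDecomposition

variable {K : Type} [Field K] [NumberField K]

/-- **(C3) ON THE S3c FRAME: `ker κ' = ψ_{W*}⁻¹(±1)`.** For a member `C • W = cm7^{(d)}` (`d ≠ 0`), `K` imaginary quadratic with `2 = v v̄`,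
`π ∈ End_K(E_K)` with `π² = π − 2`, `r² = r − 2`, the summand `W* = E[𝔮_r^∞]` pinned at `v`, and ANY `ℤ₂`-extension `κ'` of `K` unramified
outside `v̄`: an element `σ ∈ Γ_K` lies in `Gal(K̄/K*_∞) = ker κ'` iff it acts on `W*` as `+1` or as `−1`.
[cite: deShalit1987, II §1.9 and §4.17] [cite: Rubin1999, §3 Cor. 3.17] [cite: Washington1997, §13.1 Thm. 13.4] -/
theorem mem_kerSubgroup_iff_smul_of_frame {d : ℤ} (hd0 : d ≠ 0) (W : WeierstrassCurve ℚ) [W.IsElliptic]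
    (C : VariableChange ℚ) (hC : C • W = cm7.quadraticTwist (d : ℚ)) (hK : IsImaginaryQuadratic K)
    (v vbar : HeightOneSpectrum (𝓞 K)) (hv : ((2 : ℕ) : 𝓞 K) ∈ v.asIdeal) (hvbar : ((2 : ℕ) : 𝓞 K) ∈ vbar.asIdeal)
    (hne : vbar ≠ v) (π : (W.baseChange K).endRing) (hrel : (π : AddMonoid.End (W.baseChange K).geomPoints) * π = π - 2)
    {r : ℤ_[2]} (hr : r * r = r - 2)
    (hclause : ∀ τ ∈ GreenbergSelmer.inertia v, ∀ x : ↥((W.baseChange K).endEigenPrimaryTorsion 2 π r), τ • x = x ∨ τ • x = -x)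
    (κ' : ZpExtension K 2) (hκ' : κ'.IsUnramifiedOutside vbar) (σ : absoluteGaloisGroup K) :
    σ ∈ κ'.kerSubgroup ↔
      ((∀ x : ↥((W.baseChange K).endEigenPrimaryTorsion 2 π r), σ • x = x) ∨
        (∀ x : ↥((W.baseChange K).endEigenPrimaryTorsion 2 π r), σ • x = -x)) := by
  haveI : Fact (Nat.Prime 2) := ⟨Nat.prime_two⟩
  have hj : W.j = -3375 := j_eq_of_smul_eq_cm7Twist hd0 W C hC
  obtain ⟨θ, hθ⟩ := exists_sq_eq_neg_seven_of_cmEndo_mem_endRing W K hj π hrel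
  obtain ⟨-, -, -, -, -, -, hgen, hscal⟩ := endEigenPrimaryTorsion_two_structure W hj K hθ π hrel hr
  refine mem_kerSubgroup_iff_smul_of_scalarAction_two hK hv hvbar hne
    (M := ↥((W.baseChange K).endEigenPrimaryTorsion 2 π r))
    (exists_pow_smul_endEigenPrimaryTorsion_eq_zero (W.baseChange K) 2 π r) ?_ ?_ ?_ ?_ ?_ κ' hκ' σ
  · -- full levels: an element of order `2^k` inside `W*`
    intro k
    obtain ⟨g, hg, hord, -⟩ := hgen k
    refine ⟨⟨g, hg⟩, ?_⟩
    rw [← hord]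
    exact (addOrderOf_injective ((W.baseChange K).endEigenPrimaryTorsion 2 π r).subtype Subtype.coe_injective ⟨g, hg⟩).symm
  · -- integer scalars on `W*[2^k]`
    intro τ k
    obtain ⟨N, hN⟩ := hscal τ k
    refine ⟨N, fun x hx ↦ Subtype.ext ?_⟩
    have hx' : 2 ^ k • (x : (W.baseChange K).geomPrimaryTorsion 2) = 0 := by
      have := congrArg Subtype.val hx
      rwa [AddSubmonoidClass.coe_nsmul, ZeroMemClass.coe_zero] at this
    rw [endEigenPrimaryTorsion.coe_smul, AddSubgroupClass.coe_zsmul]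
    exact hN x x.2 hx'
  · -- open stabilisers
    intro x
    have h := isOpen_stabilizer_endEigenPrimaryTorsion (W.baseChange K) 2 π r x
    have hset : {τ : absoluteGaloisGroup K | τ • x = x} =
        (MulAction.stabilizer (absoluteGaloisGroup K) x : Set (absoluteGaloisGroup K)) := by
      ext τ
      rw [Set.mem_setOf_eq, SetLike.mem_coe, MulAction.mem_stabilizer_iff]
    rw [hset]
    exact h
  · -- inertia at the places `w ∣ 2`, `w ≠ v̄`, i.e. at `w = v`: the pinning clause
    intro w hw hwne
    rcases eq_or_eq_of_two_mem K hK.1 hv hvbar hne hw with rfl | rfl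
    · exact hclause
    · exact absurd rfl hwne
  · -- an element acting neither as `+1` nor as `−1`: inertia at `v̄` is not pointwise `±1` on `W*`
    obtain ⟨-, hnot⟩ := endEigenPrimaryTorsion_two_pinningClause_swap W K hj hK hθ π hrel hr hv hvbar hne hclause
    by_contra hall
    apply hnot
    intro τ _ x
    by_contra hx
    rw [not_or] at hx
    exact hall ⟨τ, fun h ↦ hx.1 (h x), fun h ↦ hx.2 (h x)⟩

/-- **(C3-loc) VERBATIM** (-w2 g9's hypothesis `hC3` of B15 files 9/11/12/13): on the S3c frame, for every `σ` in the decomposition group at `v̄`,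
`σ ∈ ker κ'` iff `σ` acts on `W*` as `+1` or as `−1`. [cite: deShalit1987, II §1.9 and §4.17] [cite: Rubin1999, §3 Cor. 3.17] -/
theorem kerC3_loc_of_frame {d : ℤ} (hd0 : d ≠ 0) (W : WeierstrassCurve ℚ) [W.IsElliptic]
    (C : VariableChange ℚ) (hC : C • W = cm7.quadraticTwist (d : ℚ)) (hK : IsImaginaryQuadratic K)
    (v vbar : HeightOneSpectrum (𝓞 K)) (hv : ((2 : ℕ) : 𝓞 K) ∈ v.asIdeal) (hvbar : ((2 : ℕ) : 𝓞 K) ∈ vbar.asIdeal)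
    (hne : vbar ≠ v) (π : (W.baseChange K).endRing) (hrel : (π : AddMonoid.End (W.baseChange K).geomPoints) * π = π - 2)
    {r : ℤ_[2]} (hr : r * r = r - 2)
    (hclause : ∀ τ ∈ GreenbergSelmer.inertia v, ∀ x : ↥((W.baseChange K).endEigenPrimaryTorsion 2 π r), τ • x = x ∨ τ • x = -x)
    (κ' : ZpExtension K 2) (hκ' : κ'.IsUnramifiedOutside vbar) :
    ∀ σ ∈ decomp vbar, σ ∈ κ'.kerSubgroup ↔
      ((∀ x : ↥((W.baseChange K).endEigenPrimaryTorsion 2 π r), σ • x = x) ∨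
        (∀ x : ↥((W.baseChange K).endEigenPrimaryTorsion 2 π r), σ • x = -x)) :=
  fun σ _ ↦ mem_kerSubgroup_iff_smul_of_frame hd0 W C hC hK v vbar hv hvbar hne π hrel hr hclause κ' hκ' σ

/-- **THE RESIDUAL (R-DYADIC) OF THE S3c ASSEMBLY, DISCHARGED** — the hypothesis `hDy` of the LEAD's `restrictedControl_two_of_residuals_noC1`
(cut 5, p667159) VERBATIM: the `2`-adic valuation of the dyadic local control kernel `#LK_{v̄}` is a function `ev` of the `2`-adic class
`[d]₂` on every S3c frame (`ev = e_{v̄}`: `1` on `d ≡ 7 (8)`, `d ≡ 2, 6, 10 (16)`; `0` on `d ≡ 3 (8)`, `d ≡ 14 (16)` — -w2 g9's table, B15 §3),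
by -w2 g9's `exists_ev_padicValNat_natCard_localKer_vbar_of_kerC3` ((R-DYADIC) ⟸ (C3-loc)) and `kerC3_loc_of_frame`.
[cite: Agboola2007, §3 Prop. 3.2 and §6] [cite: Rubin1999, §3 Lemma 3.6 (ii) and Cor. 3.17] [cite: deShalit1987, II §4.17] -/
theorem dyadicResidual_holds :
    ∃ ev : ℤ → ℤ → ℤ, ∀ (d : ℤ), d ≠ 0 → Squarefree d → d % 4 ≠ 1 →
      ∀ (W : WeierstrassCurve ℚ) [W.IsElliptic] (C : VariableChange ℚ), C • W = cm7.quadraticTwist (d : ℚ) →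
      ∀ (K : Type) [Field K] [NumberField K], IsImaginaryQuadratic K →
      ∀ (v vbar : HeightOneSpectrum (𝓞 K)),
        ((2 : ℕ) : 𝓞 K) ∈ v.asIdeal → ((2 : ℕ) : 𝓞 K) ∈ vbar.asIdeal → vbar ≠ v →
      ∀ (π : (W.baseChange K).endRing), (π : AddMonoid.End (W.baseChange K).geomPoints) * π = π - 2 →
      ∀ (r : ℤ_[2]), r * r = r - 2 →
        (∀ τ ∈ GreenbergSelmer.inertia v, ∀ x : ↥((W.baseChange K).endEigenPrimaryTorsion 2 π r), τ • x = x ∨ τ • x = -x) →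
      ∀ (κ' : ZpExtension K 2), κ'.IsUnramifiedOutside vbar →
        (padicValNat 2 (Nat.card (resOfLe ↥((W.baseChange K).endEigenPrimaryTorsion 2 π r)
          (inf_le_inf_right (decomp vbar) (le_top : κ'.kerSubgroup ≤ ⊤))).ker) : ℤ) = ev (d % 2) ((d / (2 - d % 2)) % 8) := by
  obtain ⟨ev, hev⟩ := exists_ev_padicValNat_natCard_localKer_vbar_of_kerC3
  refine ⟨ev, ?_⟩
  intro d hd0 hsq hd4 W _ C hC L _ _ hL v vbar hv hvbar hne π hrel r hr hclause κ' hκ'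
  exact hev d hd0 hsq hd4 W C hC L hL v vbar hv hvbar hne π hrel r hr hclause κ' hκ'
    (kerC3_loc_of_frame hd0 W C hC hL v vbar hv hvbar hne π hrel hr hclause κ' hκ')

end Summit.BirchSwinnertonDyer.BirchSwinnertonDyer.Theorems.PrintCf2.RestrictedSelmerPair

end
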